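import Mathlib
import HarnessLib
import Summits.HubbardSuperconductivity.HubbardSuperconductivity.Theorems.WeakCouplingBCSKlCertTPrimePocketRadiusSmooth
import Summits.HubbardSuperconductivity.HubbardSuperconductivity.Theorems.WeakCouplingBCSKlCertTPrimeConvexity

/-!
# Route `WeakCouplingBCS` — certificate half of stmt-HubbardSuperconductivity-0158, item (N3)′ of «TPRIME-LINDHARD-HS» (pen (R474)(A)(3)), file F1:
# the C² FRAME, the NORMAL FORM and the GAUSS MAP of the Γ-centred polar chart `kltpPolar tp μ` of the `t`–`t′` band

Cell `gate-hubbard-kl`, seat p4 (g24); zero kit.  The `t′`-twin of `Literature…HubbardFermiBandCurvature` (which treats `t′ = 0` with the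
closed-form radius `bandFermiRadius`), for the implicit radius `u = kltpRadius tp μ` of margin-1's chart stack (✓ `…PocketRadius`,
`…PocketRadiusContinuous`, `…PocketRadiusVelocity`, `…PocketRadiusSmooth`) on the Γ-window `|t′| < 1/2`, `−4 − 4t′ < μ < 4t′`:

* §1 `kltpRadiusDeriv2 = u″` (`deriv u′`; `u′ = kltpRadiusDeriv` is `C^∞`), the Cartesian frame `x = u cos θ`, `y = u sin θ`, velocity
  `(x′, y′)`, acceleration `(x″, y″)` with their `HasDerivAt` chain, continuity;
* §2 the level identity `ε_{t′}(x, y) = μ`, TANGENCY `ε_x x′ + ε_y y′ = 0` and the SECOND-ORDER identity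
  `ε_xx x′² + 2ε_xy x′y′ + ε_yy y′² + ε_x x″ + ε_y y″ = 0` (partials `KlTPrimeConvexity.dx/dy/dxx/dxy/dyy`);
* §3 the NORMAL FORM `(ε_x, ε_y)(γθ) = c·(y′, −x′)`, `c = kltpNormalCoeff = ∂_tF_{t′}/u > 0` (from `u′ = −∂_θF/∂_tF`), hence
  `kltpHessForm := ε_xx x′² + 2ε_xy x′y′ + ε_yy y′² = c·(x′y″ − y′x″)` and `curvNum t′ x y = c²·kltpHessForm`;
* the normal angle `α = θ − arctan(u′/u)` with `(ε_x, ε_y) = ρ(cos α, sin α)`, `ρ > 0`, and `α′ = (u² + 2u′² − uu″)/(u² + u′²)`.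
The consequences of strict convexity (`α′ > 0`, Gauss-map injectivity modulo the half turn) and the half-turn symmetry of the frame are in the
companion `…KlCertTPrimePocketGaussMap`.

Honest framing: elementary differential geometry of one explicit level curve; nothing here asserts (N3)′, an HS row, a margin, `K₃`, `U₀`, the window
or superconductivity; a Kohn–Luttinger `O(U²)` channel statement is not ODLRO; nothing here proves superconductivity in the Hubbard model.
References: S. Raghu, S. A. Kivelson, D. J. Scalapino, Phys. Rev. B 81 (2010) 224505, §II; G. Benfatto, A. Giuliani, V. Mastropietro,
Ann. Henri Poincaré 7 (2006) 809, §1 (1.5) (polar parametrisation of a strictly convex Fermi curve).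
-/

noncomputable section

-- the tree's namespace `Summit.<Summit>.<Problem>.Theorems` repeats the summit name by design (D-0017)
set_option linter.dupNamespace false

namespace Summit.HubbardSuperconductivity.HubbardSuperconductivity.Theorems

open Real Set Filter Literature.MathematicalPhysics.QuantumLattice KlTPrimeConvexity
open scoped Topology ContDiff

/-! ### §1 The second derivative of the radius and the Cartesian frame -/

/-- The second angular derivative `u″(θ)` of the `t′` band radius. [folklore] -/
def kltpRadiusDeriv2 (tp μ θ : ℝ) : ℝ := deriv (kltpRadiusDeriv tp μ) θ

/-- `x(θ) = u(θ) cos θ`, the first coordinate of `kltpPolar tp μ θ`. [folklore] -/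
def kltpX (tp μ θ : ℝ) : ℝ := kltpRadius tp μ θ * Real.cos θ

/-- `y(θ) = u(θ) sin θ`, the second coordinate of `kltpPolar tp μ θ`. [folklore] -/
def kltpY (tp μ θ : ℝ) : ℝ := kltpRadius tp μ θ * Real.sin θ

/-- `x′(θ) = u′ cos θ − u sin θ`. [folklore] -/
def kltpVX (tp μ θ : ℝ) : ℝ := kltpRadiusDeriv tp μ θ * Real.cos θ - kltpRadius tp μ θ * Real.sin θ

/-- `y′(θ) = u′ sin θ + u cos θ`. [folklore] -/
def kltpVY (tp μ θ : ℝ) : ℝ := kltpRadiusDeriv tp μ θ * Real.sin θ + kltpRadius tp μ θ * Real.cos θ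

/-- `x″(θ) = u″ cos θ − 2u′ sin θ − u cos θ`. [folklore] -/
def kltpAX (tp μ θ : ℝ) : ℝ :=
  kltpRadiusDeriv2 tp μ θ * Real.cos θ - 2 * kltpRadiusDeriv tp μ θ * Real.sin θ - kltpRadius tp μ θ * Real.cos θ

/-- `y″(θ) = u″ sin θ + 2u′ cos θ − u sin θ`. [folklore] -/
def kltpAY (tp μ θ : ℝ) : ℝ :=
  kltpRadiusDeriv2 tp μ θ * Real.sin θ + 2 * kltpRadiusDeriv tp μ θ * Real.cos θ - kltpRadius tp μ θ * Real.sin θ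

/-- The normal coefficient `c = ∂_tF_{t′}(θ, u)/u` (so that `(ε_x, ε_y) = c·(y′, −x′)` on the curve). [folklore] -/
def kltpNormalCoeff (tp μ θ : ℝ) : ℝ := kltpRayDt tp θ (kltpRadius tp μ θ) / kltpRadius tp μ θ

/-- The Hessian of `ε_{t′}` along the velocity: `ε_xx x′² + 2ε_xy x′y′ + ε_yy y′²` at `(x(θ), y(θ))`. [folklore] -/
def kltpHessForm (tp μ θ : ℝ) : ℝ :=
  dxx tp (kltpX tp μ θ) (kltpY tp μ θ) * kltpVX tp μ θ ^ 2 +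
    2 * dxy tp (kltpX tp μ θ) (kltpY tp μ θ) * kltpVX tp μ θ * kltpVY tp μ θ +
    dyy tp (kltpX tp μ θ) (kltpY tp μ θ) * kltpVY tp μ θ ^ 2

/-- The normal angle `α(θ) = θ − arctan(u′/u)` (the direction of `(y′, −x′)`, i.e. of `∇ε_{t′}` on the curve). [folklore] -/
def kltpNormalAngle (tp μ θ : ℝ) : ℝ := θ - Real.arctan (kltpRadiusDeriv tp μ θ / kltpRadius tp μ θ)

/-- `α′ = (u² + 2u′² − u u″)/(u² + u′²)`. [folklore] -/
def kltpNormalAngleDeriv (tp μ θ : ℝ) : ℝ :=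
  (kltpRadius tp μ θ ^ 2 + 2 * kltpRadiusDeriv tp μ θ ^ 2 - kltpRadius tp μ θ * kltpRadiusDeriv2 tp μ θ) /
    (kltpRadius tp μ θ ^ 2 + kltpRadiusDeriv tp μ θ ^ 2)

/-- `x` is the first coordinate of the polar point. [folklore] -/
@[simp] theorem kltpPolar_apply_zero' (tp μ θ : ℝ) : kltpPolar tp μ θ 0 = kltpX tp μ θ := kltpPolar_apply_zero tp μ θ

/-- `y` is the second coordinate of the polar point. [folklore] -/
@[simp] theorem kltpPolar_apply_one' (tp μ θ : ℝ) : kltpPolar tp μ θ 1 = kltpY tp μ θ := kltpPolar_apply_one tp μ θ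

section Window

variable {tp μ : ℝ} (htp : |tp| < 1 / 2) (hμ₁ : -4 - 4 * tp < μ) (hμ₂ : μ < 4 * tp)
include htp hμ₁ hμ₂

/-- `u′` is smooth (it is `deriv u` of the smooth radius). [folklore] -/
theorem contDiff_kltpRadiusDeriv : ContDiff ℝ ∞ (kltpRadiusDeriv tp μ) := by
  have h : ContDiff ℝ ∞ (deriv^[1] (kltpRadius tp μ)) :=
    ContDiff.iterate_deriv 1 (contDiff_kltpRadius htp hμ₁ hμ₂ (n := ∞))
  have hfun : deriv (kltpRadius tp μ) = kltpRadiusDeriv tp μ := funext (deriv_kltpRadius htp hμ₁ hμ₂)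
  rwa [Function.iterate_one, hfun] at h

/-- `u′` has derivative `u″`. [folklore] -/
theorem hasDerivAt_kltpRadiusDeriv (θ : ℝ) : HasDerivAt (kltpRadiusDeriv tp μ) (kltpRadiusDeriv2 tp μ θ) θ :=
  ((contDiff_kltpRadiusDeriv htp hμ₁ hμ₂).differentiable (by simp) θ).hasDerivAt

/-- `u″` is continuous. [folklore] -/
theorem continuous_kltpRadiusDeriv2 : Continuous (kltpRadiusDeriv2 tp μ) := by
  have h := (contDiff_kltpRadiusDeriv htp hμ₁ hμ₂).continuous_deriv (by simp)
  exact h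

/-- `x` has derivative `x′`. [folklore] -/
theorem hasDerivAt_kltpX (θ : ℝ) : HasDerivAt (kltpX tp μ) (kltpVX tp μ θ) θ := by
  have h := (hasDerivAt_kltpRadius htp hμ₁ hμ₂ θ).mul (Real.hasDerivAt_cos θ)
  refine h.congr_deriv ?_
  unfold kltpVX; ring

/-- `y` has derivative `y′`. [folklore] -/
theorem hasDerivAt_kltpY (θ : ℝ) : HasDerivAt (kltpY tp μ) (kltpVY tp μ θ) θ := by
  have h := (hasDerivAt_kltpRadius htp hμ₁ hμ₂ θ).mul (Real.hasDerivAt_sin θ)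
  refine h.congr_deriv ?_
  unfold kltpVY; ring

/-- `x′` has derivative `x″`. [folklore] -/
theorem hasDerivAt_kltpVX (θ : ℝ) : HasDerivAt (kltpVX tp μ) (kltpAX tp μ θ) θ := by
  have h := ((hasDerivAt_kltpRadiusDeriv htp hμ₁ hμ₂ θ).mul (Real.hasDerivAt_cos θ)).sub
    ((hasDerivAt_kltpRadius htp hμ₁ hμ₂ θ).mul (Real.hasDerivAt_sin θ))
  refine h.congr_deriv ?_
  unfold kltpAX; ring

/-- `y′` has derivative `y″`. [folklore] -/
theorem hasDerivAt_kltpVY (θ : ℝ) : HasDerivAt (kltpVY tp μ) (kltpAY tp μ θ) θ := by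
  have h := ((hasDerivAt_kltpRadiusDeriv htp hμ₁ hμ₂ θ).mul (Real.hasDerivAt_sin θ)).add
    ((hasDerivAt_kltpRadius htp hμ₁ hμ₂ θ).mul (Real.hasDerivAt_cos θ))
  refine h.congr_deriv ?_
  unfold kltpAY; ring

/-- The frame is continuous: `x, y, x′, y′, x″, y″` are continuous functions of the angle. [folklore] -/
theorem continuous_kltpFrame :
    Continuous (kltpX tp μ) ∧ Continuous (kltpY tp μ) ∧ Continuous (kltpVX tp μ) ∧ Continuous (kltpVY tp μ) ∧
      Continuous (kltpAX tp μ) ∧ Continuous (kltpAY tp μ) := by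
  have hu := continuous_kltpRadius htp hμ₁ hμ₂
  have hu' := continuous_kltpRadiusDeriv htp hμ₁ hμ₂
  have hu'' := continuous_kltpRadiusDeriv2 htp hμ₁ hμ₂
  refine ⟨?_, ?_, ?_, ?_, ?_, ?_⟩
  · unfold kltpX; fun_prop
  · unfold kltpY; fun_prop
  · unfold kltpVX; fun_prop
  · unfold kltpVY; fun_prop
  · unfold kltpAX; fun_prop
  · unfold kltpAY; fun_prop

/-- `0 < x′² + y′² (= u² + u′²)`: the velocity never vanishes. [folklore] -/
theorem kltpVX_sq_add_kltpVY_sq_pos (θ : ℝ) : 0 < kltpVX tp μ θ ^ 2 + kltpVY tp μ θ ^ 2 := by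
  have hu := kltpRadius_pos htp hμ₁ hμ₂ θ
  have hsc := Real.sin_sq_add_cos_sq θ
  have key : kltpVX tp μ θ ^ 2 + kltpVY tp μ θ ^ 2 = kltpRadius tp μ θ ^ 2 + kltpRadiusDeriv tp μ θ ^ 2 := by
    simp only [kltpVX, kltpVY]; nlinarith [hsc]
  rw [key]; positivity

/-! ### §2 The level identity, tangency and the second-order identity -/

/-- The curve lies on the level set: `−2(cos x + cos y) − 4t′ cos x cos y = μ`. [folklore] -/
theorem kltp_level (θ : ℝ) :
    -2 * 1 * (Real.cos (kltpX tp μ θ) + Real.cos (kltpY tp μ θ)) - 4 * tp * Real.cos (kltpX tp μ θ) * Real.cos (kltpY tp μ θ) = μ := by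
  have h := kltpRay_kltpRadius htp hμ₁ hμ₂ θ
  simp only [kltpRay] at h
  simp only [kltpX, kltpY]
  linarith

omit htp hμ₁ hμ₂ in
/-- The radial derivative is the gradient against the ray direction: `∂_tF = cos θ·ε_x + sin θ·ε_y` at the polar point. [folklore] -/
theorem kltpRayDt_eq_dx_dy (θ : ℝ) :
    kltpRayDt tp θ (kltpRadius tp μ θ) =
      Real.cos θ * dx tp (kltpX tp μ θ) (kltpY tp μ θ) + Real.sin θ * dy tp (kltpX tp μ θ) (kltpY tp μ θ) := by
  simp only [kltpRayDt, dx, dy, kltpX, kltpY]; ring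

omit htp hμ₁ hμ₂ in
/-- The angular derivative is the gradient against `u·(−sin θ, cos θ)`: `∂_θF = u·(−sin θ·ε_x + cos θ·ε_y)`. [folklore] -/
theorem kltpRayDθ_eq_dx_dy (θ : ℝ) :
    kltpRayDθ tp θ (kltpRadius tp μ θ) =
      kltpRadius tp μ θ * (-Real.sin θ * dx tp (kltpX tp μ θ) (kltpY tp μ θ) + Real.cos θ * dy tp (kltpX tp μ θ) (kltpY tp μ θ)) := by
  simp only [kltpRayDθ, dx, dy, kltpX, kltpY]; ring

/-- Implicit differentiation: `u′·∂_tF = −∂_θF` at the polar point. [folklore] -/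
theorem kltpRadiusDeriv_mul_rayDt (θ : ℝ) :
    kltpRadiusDeriv tp μ θ * kltpRayDt tp θ (kltpRadius tp μ θ) = -kltpRayDθ tp θ (kltpRadius tp μ θ) := by
  rw [kltpRadiusDeriv, div_mul_cancel₀ _ (kltpRayDt_kltpRadius_pos htp hμ₁ hμ₂ θ).ne']

/-- **Tangency**: `ε_x·x′ + ε_y·y′ = 0` along the curve. [folklore] -/
theorem kltp_tangency (θ : ℝ) :
    dx tp (kltpX tp μ θ) (kltpY tp μ θ) * kltpVX tp μ θ + dy tp (kltpX tp μ θ) (kltpY tp μ θ) * kltpVY tp μ θ = 0 := by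
  have h1 : HasDerivAt (fun ϑ => -2 * 1 * (Real.cos (kltpX tp μ ϑ) + Real.cos (kltpY tp μ ϑ)) -
      4 * tp * Real.cos (kltpX tp μ ϑ) * Real.cos (kltpY tp μ ϑ))
      (-2 * 1 * (-Real.sin (kltpX tp μ θ) * kltpVX tp μ θ + -Real.sin (kltpY tp μ θ) * kltpVY tp μ θ) -
        (4 * tp * (-Real.sin (kltpX tp μ θ) * kltpVX tp μ θ) * Real.cos (kltpY tp μ θ) +
          4 * tp * Real.cos (kltpX tp μ θ) * (-Real.sin (kltpY tp μ θ) * kltpVY tp μ θ))) θ :=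
    (((hasDerivAt_kltpX htp hμ₁ hμ₂ θ).cos.add (hasDerivAt_kltpY htp hμ₁ hμ₂ θ).cos).const_mul (-2 * 1)).sub
      (((hasDerivAt_kltpX htp hμ₁ hμ₂ θ).cos.const_mul (4 * tp)).mul (hasDerivAt_kltpY htp hμ₁ hμ₂ θ).cos)
  have h2 : HasDerivAt (fun ϑ => -2 * 1 * (Real.cos (kltpX tp μ ϑ) + Real.cos (kltpY tp μ ϑ)) -
      4 * tp * Real.cos (kltpX tp μ ϑ) * Real.cos (kltpY tp μ ϑ)) 0 θ := by
    have : (fun ϑ => -2 * 1 * (Real.cos (kltpX tp μ ϑ) + Real.cos (kltpY tp μ ϑ)) -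
        4 * tp * Real.cos (kltpX tp μ ϑ) * Real.cos (kltpY tp μ ϑ)) = fun _ => μ := funext (kltp_level htp hμ₁ hμ₂)
    rw [this]; exact hasDerivAt_const θ μ
  have := h1.unique h2
  simp only [dx, dy]
  linarith

/-- **Second-order identity**: `ε_xx x′² + 2ε_xy x′y′ + ε_yy y′² + ε_x x″ + ε_y y″ = 0` along the curve. [folklore] -/
theorem kltp_hessForm_add_grad_dot_acc (θ : ℝ) :
    kltpHessForm tp μ θ + (dx tp (kltpX tp μ θ) (kltpY tp μ θ) * kltpAX tp μ θ + dy tp (kltpX tp μ θ) (kltpY tp μ θ) * kltpAY tp μ θ) = 0 := by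
  -- differentiate the tangency identity, with `ε_x, ε_y` written out
  have hX := hasDerivAt_kltpX htp hμ₁ hμ₂ θ
  have hY := hasDerivAt_kltpY htp hμ₁ hμ₂ θ
  have hVX := hasDerivAt_kltpVX htp hμ₁ hμ₂ θ
  have hVY := hasDerivAt_kltpVY htp hμ₁ hμ₂ θ
  have hdx : HasDerivAt (fun ϑ => 2 * Real.sin (kltpX tp μ ϑ) * (1 + 2 * tp * Real.cos (kltpY tp μ ϑ)))
      (2 * (Real.cos (kltpX tp μ θ) * kltpVX tp μ θ) * (1 + 2 * tp * Real.cos (kltpY tp μ θ)) +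
        2 * Real.sin (kltpX tp μ θ) * (2 * tp * (-Real.sin (kltpY tp μ θ) * kltpVY tp μ θ))) θ :=
    (hX.sin.const_mul 2).mul ((hY.cos.const_mul (2 * tp)).const_add 1)
  have hdy : HasDerivAt (fun ϑ => 2 * Real.sin (kltpY tp μ ϑ) * (1 + 2 * tp * Real.cos (kltpX tp μ ϑ)))
      (2 * (Real.cos (kltpY tp μ θ) * kltpVY tp μ θ) * (1 + 2 * tp * Real.cos (kltpX tp μ θ)) +
        2 * Real.sin (kltpY tp μ θ) * (2 * tp * (-Real.sin (kltpX tp μ θ) * kltpVX tp μ θ))) θ :=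
    (hY.sin.const_mul 2).mul ((hX.cos.const_mul (2 * tp)).const_add 1)
  have h1 := (hdx.mul hVX).add (hdy.mul hVY)
  have h2 : HasDerivAt (fun ϑ => 2 * Real.sin (kltpX tp μ ϑ) * (1 + 2 * tp * Real.cos (kltpY tp μ ϑ)) * kltpVX tp μ ϑ +
      2 * Real.sin (kltpY tp μ ϑ) * (1 + 2 * tp * Real.cos (kltpX tp μ ϑ)) * kltpVY tp μ ϑ) 0 θ := by
    have : (fun ϑ => 2 * Real.sin (kltpX tp μ ϑ) * (1 + 2 * tp * Real.cos (kltpY tp μ ϑ)) * kltpVX tp μ ϑ +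
        2 * Real.sin (kltpY tp μ ϑ) * (1 + 2 * tp * Real.cos (kltpX tp μ ϑ)) * kltpVY tp μ ϑ) = fun _ => 0 := by
      funext ϑ
      have h := kltp_tangency htp hμ₁ hμ₂ ϑ
      simp only [dx, dy] at h
      exact h
    rw [this]; exact hasDerivAt_const θ (0 : ℝ)
  have := h1.unique h2
  simp only [kltpHessForm, dx, dy, dxx, dyy, dxy]
  linear_combination this

/-! ### §3 The normal form of the gradient -/

/-- `c > 0`. [folklore] -/
theorem kltpNormalCoeff_pos (θ : ℝ) : 0 < kltpNormalCoeff tp μ θ :=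
  div_pos (kltpRayDt_kltpRadius_pos htp hμ₁ hμ₂ θ) (kltpRadius_pos htp hμ₁ hμ₂ θ)

/-- **Normal form**: `ε_x(γθ) = c·y′`. [folklore] -/
theorem kltp_dx_eq (θ : ℝ) : dx tp (kltpX tp μ θ) (kltpY tp μ θ) = kltpNormalCoeff tp μ θ * kltpVY tp μ θ := by
  have hu := kltpRadius_pos htp hμ₁ hμ₂ θ
  have h1 := kltpRayDt_eq_dx_dy (tp := tp) (μ := μ) θ
  have h2 := kltpRayDθ_eq_dx_dy (tp := tp) (μ := μ) θ
  have h3 := kltpRadiusDeriv_mul_rayDt htp hμ₁ hμ₂ θ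
  have h4 := Real.sin_sq_add_cos_sq θ
  rw [kltpNormalCoeff, div_mul_eq_mul_div, eq_div_iff hu.ne', kltpVY]
  linear_combination (-Real.sin θ) * h3 + (Real.sin θ) * h2 + (-(kltpRadius tp μ θ * Real.cos θ)) * h1 +
    (-(kltpRadius tp μ θ * dx tp (kltpX tp μ θ) (kltpY tp μ θ))) * h4

/-- **Normal form**: `ε_y(γθ) = −c·x′`. [folklore] -/
theorem kltp_dy_eq (θ : ℝ) : dy tp (kltpX tp μ θ) (kltpY tp μ θ) = -(kltpNormalCoeff tp μ θ * kltpVX tp μ θ) := by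
  have hu := kltpRadius_pos htp hμ₁ hμ₂ θ
  have h1 := kltpRayDt_eq_dx_dy (tp := tp) (μ := μ) θ
  have h2 := kltpRayDθ_eq_dx_dy (tp := tp) (μ := μ) θ
  have h3 := kltpRadiusDeriv_mul_rayDt htp hμ₁ hμ₂ θ
  have h4 := Real.sin_sq_add_cos_sq θ
  rw [kltpNormalCoeff, div_mul_eq_mul_div, ← neg_div, eq_div_iff hu.ne', kltpVX]
  linear_combination (Real.cos θ) * h3 + (-Real.cos θ) * h2 + (-(kltpRadius tp μ θ * Real.sin θ)) * h1 +
    (-(kltpRadius tp μ θ * dy tp (kltpX tp μ θ) (kltpY tp μ θ))) * h4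

/-- **The Hessian form is the normal coefficient times the velocity–acceleration cross product**: `kltpHessForm = c·(x′y″ − y′x″)`. [folklore] -/
theorem kltpHessForm_eq_cross (θ : ℝ) :
    kltpHessForm tp μ θ = kltpNormalCoeff tp μ θ * (kltpVX tp μ θ * kltpAY tp μ θ - kltpVY tp μ θ * kltpAX tp μ θ) := by
  have hE := kltp_hessForm_add_grad_dot_acc htp hμ₁ hμ₂ θ
  rw [kltp_dx_eq htp hμ₁ hμ₂, kltp_dy_eq htp hμ₁ hμ₂] at hE
  linear_combination hE

/-- **The curvature numerator is `c²` times the Hessian form**: `curvNum t′ x y = c²·kltpHessForm` on the curve (the tangent `(−ε_y, ε_x)` is `c·(x′, y′)`). [folklore] -/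
theorem kltp_curvNum_eq (θ : ℝ) :
    curvNum tp (kltpX tp μ θ) (kltpY tp μ θ) = kltpNormalCoeff tp μ θ ^ 2 * kltpHessForm tp μ θ := by
  rw [curvNum, kltpHessForm, kltp_dx_eq htp hμ₁ hμ₂, kltp_dy_eq htp hμ₁ hμ₂]
  ring

omit htp hμ₁ hμ₂ in
/-- The polar identity `x′y″ − y′x″ = u² + 2u′² − u u″`. [folklore] -/
theorem kltpCross_eq_polar (θ : ℝ) :
    kltpVX tp μ θ * kltpAY tp μ θ - kltpVY tp μ θ * kltpAX tp μ θ =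
      kltpRadius tp μ θ ^ 2 + 2 * kltpRadiusDeriv tp μ θ ^ 2 - kltpRadius tp μ θ * kltpRadiusDeriv2 tp μ θ := by
  have hsc := Real.sin_sq_add_cos_sq θ
  simp only [kltpVX, kltpVY, kltpAX, kltpAY]
  linear_combination (2 * kltpRadiusDeriv tp μ θ ^ 2 + kltpRadius tp μ θ ^ 2 -
    kltpRadius tp μ θ * kltpRadiusDeriv2 tp μ θ) * hsc

/-- `(ε_x, ε_y) = ρ (cos α, sin α)` with `ρ = c·u·√(1 + (u′/u)²) > 0`: the gradient direction IS the normal angle. [folklore] -/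
theorem kltp_dxdy_eq_polar (θ : ℝ) :
    ∃ ρ : ℝ, 0 < ρ ∧ dx tp (kltpX tp μ θ) (kltpY tp μ θ) = ρ * Real.cos (kltpNormalAngle tp μ θ) ∧
      dy tp (kltpX tp μ θ) (kltpY tp μ θ) = ρ * Real.sin (kltpNormalAngle tp μ θ) := by
  have hu := kltpRadius_pos htp hμ₁ hμ₂ θ
  have hc := kltpNormalCoeff_pos htp hμ₁ hμ₂ θ
  set q : ℝ := kltpRadiusDeriv tp μ θ / kltpRadius tp μ θ with hq
  have hsq : 0 < Real.sqrt (1 + q ^ 2) := Real.sqrt_pos.2 (by positivity)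
  refine ⟨kltpNormalCoeff tp μ θ * (kltpRadius tp μ θ * Real.sqrt (1 + q ^ 2)), by positivity, ?_, ?_⟩
  · rw [kltp_dx_eq htp hμ₁ hμ₂, kltpNormalAngle, ← hq, Real.cos_sub, Real.cos_arctan, Real.sin_arctan]
    simp only [kltpVY]
    have hq' : kltpRadiusDeriv tp μ θ = q * kltpRadius tp μ θ := by rw [hq]; field_simp
    rw [hq']
    field_simp
    ring
  · rw [kltp_dy_eq htp hμ₁ hμ₂, kltpNormalAngle, ← hq, Real.sin_sub, Real.cos_arctan, Real.sin_arctan]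
    simp only [kltpVX]
    have hq' : kltpRadiusDeriv tp μ θ = q * kltpRadius tp μ θ := by rw [hq]; field_simp
    rw [hq']
    field_simp
    ring

/-- `α` is differentiable with `α′ = (u² + 2u′² − u u″)/(u² + u′²)`. [folklore] -/
theorem hasDerivAt_kltpNormalAngle (θ : ℝ) : HasDerivAt (kltpNormalAngle tp μ) (kltpNormalAngleDeriv tp μ θ) θ := by
  have hu := kltpRadius_pos htp hμ₁ hμ₂ θ
  have hq : HasDerivAt (fun ϑ => kltpRadiusDeriv tp μ ϑ / kltpRadius tp μ ϑ)
      ((kltpRadiusDeriv2 tp μ θ * kltpRadius tp μ θ - kltpRadiusDeriv tp μ θ * kltpRadiusDeriv tp μ θ) /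
        kltpRadius tp μ θ ^ 2) θ :=
    (hasDerivAt_kltpRadiusDeriv htp hμ₁ hμ₂ θ).div (hasDerivAt_kltpRadius htp hμ₁ hμ₂ θ) hu.ne'
  have h := (hasDerivAt_id θ).sub hq.arctan
  refine h.congr_deriv ?_
  rw [kltpNormalAngleDeriv]
  have hs2 : kltpRadius tp μ θ ^ 2 + kltpRadiusDeriv tp μ θ ^ 2 ≠ 0 := by positivity
  field_simp
  ring

end Window

end Summit.HubbardSuperconductivity.HubbardSuperconductivity.Theorems

end
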